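import Summits.RiemannHypothesis.RiemannHypothesis.Theses.LindelofBridge
import Literature.NumberTheory.LFunctions.ZetaSubconvexity

/-!
# Birth skeleton (BC3) for crux `LindelofHypothesis` — route `LindelofBridge`, item stmt-RiemannHypothesis-14271

The crux is the route's declared premise, BY NAME:
`Summit.RiemannHypothesis.RiemannHypothesis.Theses.LindelofBridge.LindelofHypothesis :=
Literature.NumberTheory.LFunctions.LindelofHypothesis` (`∀ ε > 0, ζ(1/2 + it) = O(t^ε)`,
`t → +∞`).  It is an OPEN PROBLEM (Lindelöf 1908) and the route is CONDITIONAL on it; this file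
does not claim progress on it.  It records the ONE line along which every partial result towards
it has been obtained (Weyl 1/6, …, Bourgain 13/84 = `Literature.NumberTheory.LFunctions.bourgain_subconvexity`),
cut at its clean seams, in the tree's own exponential-sum vocabulary
(`Literature.NumberTheory.LFunctions.bourgainSum`, file `Literature/NumberTheory/LFunctions/ZetaSubconvexity.lean`):

Line `birth` = **square-root cancellation in the dyadic zeta sums, transferred through the
approximate functional equation** (Bourgain, *J. Amer. Math. Soc.* 30 (2017) §5; Titchmarsh 1986
Thm 4.15 / (4.17.1); Graham–Kolesnik 1991 §1.2: an exponent pair `(k, l)` gives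
`ζ(1/2 + it) ≪ t^{(k + l − 1/2)/2} log t`, so the conjectural pair `(ε, 1/2 + ε)` gives Lindelöf).
With Bourgain's normalisation `S(T, M) = ∑_{M/2 ≤ m ≤ M} e(T log(m/M))`, `|S| = |∑_{m ∼ M} m^{it}|`,
`t = 2πT` (`norm_bourgainSum_log`, proved):

* `stub_decouplingRange` (OPEN): for every `ε > 0`, `|S(T, M)| ≤ C(ε) √M T^ε` on Bourgain's
  Theorem-4 range `T^{17/42} ≤ M ≤ √T` — i.e. the tree's named fact
  `Literature.NumberTheory.LFunctions.Bourgain2017_theorem4_log` with the exponent `13/84` replaced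
  by `0` (the range owned today by `ℓ²`-decoupling + Bombieri–Iwaniec + Huxley–Watt).
* `stub_shortRange` (OPEN): the same bound on the complementary range `1 ≤ M < T^{17/42}` — the
  range owned today by Huxley's estimate (4.1) and the exponent pair (4.2)
  (`Bourgain2017_eq41_log`, `Bourgain2017_eq42_log`), again with target exponent `0`.
  (For `M ≤ T^{2ε}` it is trivial: `|S| ≤ M ≤ √M T^ε`; the content is `T^{2ε} < M < T^{17/42}`.)
  The two ranges are those of the tree's Bourgain files; the split point `17/42` has no intrinsic
  meaning for the `ε`-target — it records which toolbox currently owns which range, and neither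
  range implies the other (no monotonicity in `M`).
* `stub_exponentTransfer` (KNOWN in print, absent from the tree for general exponent; size M):
  for every `θ ≥ 0`, a dyadic bound `|S(T, M)| ≤ C(ε) √M T^{θ+ε}` (`1 ≤ M ≤ √T`, all `ε > 0`)
  transfers to `ζ(1/2 + it) = O(t^{θ+ε})` for all `ε > 0`.  For `θ = 13/84` this is exactly the
  tree's PROVED `Literature.NumberTheory.LFunctions.bourgain_subconvexity_of_eq43_of_eq51`
  (with `Bourgain2017_eq43_holds`, the approximate functional equation on `σ = 1/2`, PROVED in
  `ApproxFunctionalEquation.lean`, and the proved dyadic dissection / partial summation lemmas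
  `norm_sum_cpow_mul_I_le_of_dyadic`, `norm_sum_cpow_neg_half_le`); the stub is that proof with
  `13/84 ↦ θ` (Graham–Kolesnik §1.2; Bourgain §5 "in the usual way").

`LindelofHypothesis_of : <stub₁> → <stub₂> → <stub₃> → LindelofBridge.LindelofHypothesis` is the
real composition (glue the two ranges into the full range `1 ≤ M ≤ √T` with exponent `0 + ε`,
transfer at `θ = 0`, unfold the crux to `Literature.NumberTheory.LFunctions.LindelofHypothesis`);
`LindelofHypothesis_proof` feeds it the three sorried stubs.  Sorries: exactly `stub_decouplingRange`,
`stub_shortRange`, `stub_exponentTransfer`.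

Transfer / why this currency: stubs 1–2 together are Lindelöf-strength (conversely LH gives them
by a truncated-Perron argument, Titchmarsh §13.3 with `k = 1`; neither direction is in the tree),
but they expose the statement to the only tools that have ever moved `μ(1/2)`: Weyl–van der Corput
differencing (tree: `VanDerCorputZeta.lean`, `VanDerCorputDerivTests.lean`), the `B`-process
(`VanDerCorputBProcess.lean`), Bombieri–Iwaniec/Huxley and `ℓ²`-decoupling
(`BourgainTheorem4*.lean`); and the AFE half of the bridge is already PROVED in the tree.
Disproof used: none on file for this crux (`ledger crux ls stmt-RiemannHypothesis-14271`: no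
`Disproof.lean`); no landed `Negative/` lemma concerns these statements.
-/

namespace Summit.RiemannHypothesis.RiemannHypothesis.Cruxes.LindelofHypothesis.Birth

open Complex Filter Asymptotics

/-! ## The registered stubs (full signatures over importable declarations; `sorry` lives only here) -/

/-- **Stub 1 (OPEN) — square-root cancellation on the decoupling range.** For every `ε > 0`
there are `C, T₀` with `‖∑_{M/2 ≤ m ≤ M} e(T log(m/M))‖ ≤ C √M T^ε` whenever `T ≥ T₀` and
`T^{17/42} ≤ M ≤ √T` (Bourgain 2017, Theorem 4 / eq. (3.19) for `F = log`, with `13/84 ↦ 0`;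
tree: `Literature.NumberTheory.LFunctions.Bourgain2017_theorem4_log`).
[cite: BourgainJAMS2017, Theorem 4, eq. (3.19), (5.1)] -/
theorem stub_decouplingRange :
    ∀ ε : ℝ, 0 < ε → ∃ C T₀ : ℝ, ∀ T : ℝ, T₀ ≤ T → ∀ M : ℝ,
      T ^ (17 / 42 : ℝ) ≤ M → M ≤ Real.sqrt T →
        ‖Literature.NumberTheory.LFunctions.bourgainSum Real.log T M‖ ≤
          C * Real.sqrt M * T ^ ε := by
  sorry

/-- **Stub 2 (OPEN) — square-root cancellation on the short range.** For every `ε > 0` there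
are `C, T₀` with `‖∑_{M/2 ≤ m ≤ M} e(T log(m/M))‖ ≤ C √M T^ε` whenever `T ≥ T₀` and
`1 ≤ M < T^{17/42}` (the range of Bourgain's (4.1)–(4.2), tree:
`Literature.NumberTheory.LFunctions.Bourgain2017_eq41_log`, `Bourgain2017_eq42_log`, with target
exponent `0`; trivial for `M ≤ T^{2ε}`). [cite: BourgainJAMS2017, §5 eqs. (4.1), (4.2), (5.1)]
[cite: Graham–Kolesnik 1991, §1.2 and Ch. 3 (exponent pairs)] -/
theorem stub_shortRange :
    ∀ ε : ℝ, 0 < ε → ∃ C T₀ : ℝ, ∀ T : ℝ, T₀ ≤ T → ∀ M : ℝ,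
      1 ≤ M → M < T ^ (17 / 42 : ℝ) →
        ‖Literature.NumberTheory.LFunctions.bourgainSum Real.log T M‖ ≤
          C * Real.sqrt M * T ^ ε := by
  sorry

/-- **Stub 3 (KNOWN, not in tree for general `θ`) — exponent transfer through the approximate
functional equation.** For every `θ ≥ 0`: if for every `ε > 0` there are `C, T₀` with
`‖∑_{M/2 ≤ m ≤ M} e(T log(m/M))‖ ≤ C √M T^{θ+ε}` for `T ≥ T₀`, `1 ≤ M ≤ √T`, then
`ζ(1/2 + it) = O(t^{θ+ε})` for every `ε > 0`.  The case `θ = 13/84` is the tree's proved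
`Literature.NumberTheory.LFunctions.bourgain_subconvexity_of_eq43_of_eq51` (AFE
`Bourgain2017_eq43_holds` + `norm_sum_cpow_mul_I_le_of_dyadic` + `norm_sum_cpow_neg_half_le`);
the proof for general `θ` is the same with `13/84 ↦ θ`.
[cite: BourgainJAMS2017, §5 eq. (4.3) and Theorem 5] [cite: Titchmarsh1986, Thm 4.15, (4.17.1)]
[cite: Graham–Kolesnik 1991, §1.2] -/
theorem stub_exponentTransfer :
    ∀ θ : ℝ, 0 ≤ θ →
      (∀ ε : ℝ, 0 < ε → ∃ C T₀ : ℝ, ∀ T : ℝ, T₀ ≤ T → ∀ M : ℝ, 1 ≤ M → M ≤ Real.sqrt T →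
        ‖Literature.NumberTheory.LFunctions.bourgainSum Real.log T M‖ ≤
          C * Real.sqrt M * T ^ (θ + ε)) →
      ∀ ε : ℝ, 0 < ε →
        (fun t : ℝ => riemannZeta (1 / 2 + t * I)) =O[atTop] fun t : ℝ => t ^ (θ + ε) := by
  sorry

/-! ## The composition (proved, no `sorry`): the crux BY NAME from the three stub statements -/

/-- `stub_decouplingRange → stub_shortRange → stub_exponentTransfer → LindelofHypothesis`
(the route decl, by name): glue the two `M`-ranges into `1 ≤ M ≤ √T` with exponent `0 + ε`,
apply the transfer at `θ = 0`, and unfold the crux to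
`Literature.NumberTheory.LFunctions.LindelofHypothesis`. -/
theorem LindelofHypothesis_of
    (h₁ : ∀ ε : ℝ, 0 < ε → ∃ C T₀ : ℝ, ∀ T : ℝ, T₀ ≤ T → ∀ M : ℝ,
      T ^ (17 / 42 : ℝ) ≤ M → M ≤ Real.sqrt T →
        ‖Literature.NumberTheory.LFunctions.bourgainSum Real.log T M‖ ≤
          C * Real.sqrt M * T ^ ε)
    (h₂ : ∀ ε : ℝ, 0 < ε → ∃ C T₀ : ℝ, ∀ T : ℝ, T₀ ≤ T → ∀ M : ℝ,
      1 ≤ M → M < T ^ (17 / 42 : ℝ) →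
        ‖Literature.NumberTheory.LFunctions.bourgainSum Real.log T M‖ ≤
          C * Real.sqrt M * T ^ ε)
    (h₃ : ∀ θ : ℝ, 0 ≤ θ →
      (∀ ε : ℝ, 0 < ε → ∃ C T₀ : ℝ, ∀ T : ℝ, T₀ ≤ T → ∀ M : ℝ, 1 ≤ M → M ≤ Real.sqrt T →
        ‖Literature.NumberTheory.LFunctions.bourgainSum Real.log T M‖ ≤
          C * Real.sqrt M * T ^ (θ + ε)) →
      ∀ ε : ℝ, 0 < ε →
        (fun t : ℝ => riemannZeta (1 / 2 + t * I)) =O[atTop] fun t : ℝ => t ^ (θ + ε)) :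
    Summit.RiemannHypothesis.RiemannHypothesis.Theses.LindelofBridge.LindelofHypothesis := by
  -- (1) the full range `1 ≤ M ≤ √T`, exponent written as `0 + ε`
  have hfull : ∀ ε : ℝ, 0 < ε → ∃ C T₀ : ℝ, ∀ T : ℝ, T₀ ≤ T → ∀ M : ℝ, 1 ≤ M →
      M ≤ Real.sqrt T →
        ‖Literature.NumberTheory.LFunctions.bourgainSum Real.log T M‖ ≤
          C * Real.sqrt M * T ^ ((0 : ℝ) + ε) := by
    intro ε hε
    obtain ⟨C₁, T₁, hC₁⟩ := h₁ ε hε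
    obtain ⟨C₂, T₂, hC₂⟩ := h₂ ε hε
    refine ⟨max C₁ C₂, max (max T₁ T₂) 0, fun T hT M hM₁ hM₂ => ?_⟩
    have hT₁ : T₁ ≤ T := le_trans (le_trans (le_max_left _ _) (le_max_left _ _)) hT
    have hT₂ : T₂ ≤ T := le_trans (le_trans (le_max_right _ _) (le_max_left _ _)) hT
    have hT₀ : 0 ≤ T := le_trans (le_max_right _ _) hT
    rw [zero_add]
    have hX : 0 ≤ Real.sqrt M * T ^ ε :=
      mul_nonneg (Real.sqrt_nonneg _) (Real.rpow_nonneg hT₀ _)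
    rcases le_or_gt (T ^ (17 / 42 : ℝ)) M with hM | hM
    · calc ‖Literature.NumberTheory.LFunctions.bourgainSum Real.log T M‖
          ≤ C₁ * Real.sqrt M * T ^ ε := hC₁ T hT₁ M hM hM₂
        _ = C₁ * (Real.sqrt M * T ^ ε) := by ring
        _ ≤ max C₁ C₂ * (Real.sqrt M * T ^ ε) :=
          mul_le_mul_of_nonneg_right (le_max_left _ _) hX
        _ = max C₁ C₂ * Real.sqrt M * T ^ ε := by ring
    · calc ‖Literature.NumberTheory.LFunctions.bourgainSum Real.log T M‖
          ≤ C₂ * Real.sqrt M * T ^ ε := hC₂ T hT₂ M hM₁ hM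
        _ = C₂ * (Real.sqrt M * T ^ ε) := by ring
        _ ≤ max C₁ C₂ * (Real.sqrt M * T ^ ε) :=
          mul_le_mul_of_nonneg_right (le_max_right _ _) hX
        _ = max C₁ C₂ * Real.sqrt M * T ^ ε := by ring
  -- (2) transfer at `θ = 0`
  have hz := h₃ 0 le_rfl hfull
  -- (3) the crux, by name, is `Literature.NumberTheory.LFunctions.LindelofHypothesis`
  show ∀ ε : ℝ, 0 < ε →
    (fun t : ℝ => riemannZeta (1 / 2 + t * I)) =O[atTop] fun t : ℝ => t ^ ε
  intro ε hε
  simpa only [zero_add] using hz ε hε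

/-- **The skeleton**: the crux BY NAME from the three registered stubs (sorries only inside
them). -/
theorem LindelofHypothesis_proof :
    Summit.RiemannHypothesis.RiemannHypothesis.Theses.LindelofBridge.LindelofHypothesis :=
  LindelofHypothesis_of stub_decouplingRange stub_shortRange stub_exponentTransfer

end Summit.RiemannHypothesis.RiemannHypothesis.Cruxes.LindelofHypothesis.Birth
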